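import Literature.NumberTheory.Rogawski1990.AdelicCartanDisc
import Literature.NumberTheory.Rogawski1990.MatchingAdeleGLConjOfIntegralConj
import Literature.LinearAlgebra.Matrix.IntegralUnitaryConjugacyOfIdempotents
import HarnessLib

/-!
# The obstruction of a SINGULAR semisimple stable class of `U(H)`: the block determinant of the adelic Cartan class and its quadratic
# norm class `obs_s : 𝒞′_𝐀(γ₀) → ℤ∕2` (Rogawski 1990, §3.8 Prop. 3.8.1 (a)(d) p. 37, §3.3 (3.3.1) p. 22; Kottwitz 1986 §9)

Topic `NumberTheory/Rogawski1990`; namespace `Literature.NumberTheory.Rogawski1990`; DEFINITIONS with bodies (`blockDet`, `adelicLagrangeIdem`,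
`adelicBlockDet`, `IsPrincipalAdelicNorm`, `MatchingAdeleG₂.singularObs`) + their unfolding ∕ well-definedness theorems; **no named fact, no
`sorry`, no instance, no notation**.  Cell `pub/hodgecm-mathlib`, ENGINE T1 (crux H413 = `stmt-HodgeConjecture-24833`), O7 «SINGULAR semisimple
stable classes» (CENSUS-O7 v3 §3, O7 OWNER WORD #7 (ii) «O7-obs»): the object `obs` of the PLACEWISE singular ObsHasse socket ★
`MatchingAdeleG₂.obsHasse_of_placewise` (`ObsHasseOfStepsSemisimple` ED. 2) at a singular `γ₀`, companion of the regular ★ `MatchingAdeleG₂.cartanObsFun`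
(`CartanObstruction`).  HC_CM is proved only modulo the printed citations until rung 0 closes.

THE PRINT.  [Rogawski1990, §3.8 Prop. 3.8.1 p. 37]: for `γ` semisimple SINGULAR non-central in `G = U(3)` (eigenvalues `(a, a, b)`) the centraliser is
`G_γ ≅ U(2) × U(1)` (for `D = M₃(E)`), (a) the classes inside the stable class of `γ` correspond to `F^*∕N E^*` through the cohomology of
`1 → SL(2) → U(2) → E¹ → 1` (the DETERMINANT of the rank-2 block; `|A(G_γ^d)| = 2` by Lemma 3.5.1 (a)), (d) globally the classes are parametrised
by `ξ ∈ F^*∕N E^*` with sign conditions at the compact real places; [§3.3 (3.3.1) p. 22]: `obs(γ′)` is the image of the class `{τ(g) g⁻¹}` for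
`γ′ = g γ g⁻¹`; [Kottwitz1986, §9]: the same through `𝔈(G_γ∕F)`.

DESIGN — FRAME-FREE.  No adapted frame of `γ₀` enters: the rank-2 block is cut out by the LAGRANGE IDEMPOTENT `e = (a − b)⁻¹(γ₀ − b)` (a polynomial
in `γ₀`, hence central in `Z(γ₀)`; `⋆`-self-adjoint because `γ₀` is `H`-unitary with unitary eigenvalues `a ā = b b̄ = 1`, ★
`hermAdjoint_lagrange_idem_eq`), and «det of the block of `X ∈ Z(γ₀ ⊗ 1)`» is `blockDet e X := det (e X e + (1 − e))`.
* §1 (any commutative ring with involution `σ` and form `H`; `⋆ = hermStar σ H`): `blockDet`, multiplicative on the commutant of an idempotent `e`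
  (`blockDet_mul`), `blockDet e X⋆ = σ (blockDet e X)` for `e⋆ = e` (`blockDet_hermStar`), units (`isUnit_blockDet`), and the NORM-CLASS LAW
  **`blockDet_hermStar_mul_mul`**: `blockDet e (t⋆ X t) = σ(blockDet e t) · blockDet e X · blockDet e t` for `t, X ∈ Z(e)`.
* §2 (CM letters: `L` CM, `H ∈ M₃(L)`, `γ₀ ∈ U(H)(L⁺)` rational with `(γ₀ − a)(γ₀ − b) = 0`, `a ≠ b` — the binders of ★ (P3-s)
  `exists_gl_conj_eq_adele_of_mul_sub_eq_zero`; `x_g := (H ⊗ 1)⁻¹ ᵗ(σ𝔸 g)(H ⊗ 1) g` the adelic Cartan class of ★ `AdelicCartanClass`):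
  `adelicLagrangeIdem γ₀ a b = e ⊗ 1` (idempotent, central in `Z(γ₀ ⊗ 1)`, `⋆`-self-adjoint), **`adelicBlockDet γ₀ a b g := blockDet (e ⊗ 1) x_g`** —
  `σ𝔸`-FIXED (`adeleConj_adelicBlockDet`), an adelic UNIT for a conjugator of a matching adèle (`isUnit_adelicBlockDet`), and changing by a NORM
  `σ𝔸(c) c` when the conjugator changes or `p` moves in its `U(H)(𝐀)`-class (`exists_adelicBlockDet_eq_adeleConj_mul_mul{,_of_isConjAdele}` over ★
  `exists_commute_adelicCartan_eq_of_conj_eq` ∕ `…_of_isConjAdele`).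
* §3 `IsPrincipalAdelicNorm L δ :↔ δ = (k ⊗ 1) · σ𝔸(z) z` with `k ∈ L⁺ˣ` (global, `c`-fixed) and `z ∈ 𝔸_Lˣ` — «GLOBAL × NORM», the `𝔸_L`-side text of
  «the descended idèle lies in `(L⁺)ˣ · N(𝕀_L)`», i.e. of the vanishing of the quadratic Artin symbol of `L∕L⁺` (★ `coe_ideleBaseChange_principal_mul_ideleRelNorm`,
  ★ `quadraticArtinIndicator_eq_zero_iff_exists_ideleRelNorm`); **`MatchingAdeleG₂.singularObs hab hγ₀ p : ZMod 2`** := `0` iff the block determinant of the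
  CHOSEN adelic conjugator (★ (P3-s)) is «global × norm»; **`singularObs_eq_zero_iff`** — the same for ANY conjugator (well-definedness),
  `singularObs_eq_of_isConjAdele` (a class function on `𝒞′_𝐀(γ₀)`), `singularObs_self` (`obs_s(γ₀ ⊗ 1) = 0`), `singularObs_eq_zero_or_eq_one`.

NOT here (kernel-lane sequels): the `hvan` clause of the socket («`x_g = t⋆ (y ⊗ 1) t` with `y` global ⇒ `obs_s p = 0`»), and the reading
`singularObs p = quadraticArtinIndicator L⁺ d W` on the descended idèle `W` (★ `HasseNormEtaleInvolutionDescent` (E1)(E5), mirror of ★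
`cartanObsFun_eq_quadraticArtinIndicator`) — `SingularObstructionVanishing` ∕ `…Indicator`; the `hreal` half is B-p12's (R6a-s)(P2-s) + B-p14's (P1-s).

## References
* [Rogawski1990] J. D. Rogawski, *Automorphic Representations of Unitary Groups in Three Variables*, Ann. of Math. Stud. 123 (1990), §3.3 (3.3.1) p. 22;
  §3.5 Prop. 3.5.2 p. 29; §3.8 Prop. 3.8.1 p. 37; §5.4 p. 72.
* [Kottwitz1986] R. E. Kottwitz, *Stable trace formula: elliptic singular terms*, Math. Ann. 275 (1986), §7 Prop. 7.1, §9.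
* [CasselsFrohlichANT1967] Cassels–Fröhlich (eds.), *Algebraic Number Theory* (1967), Ch. VII §7.3 (a).
-/

set_option autoImplicit false

noncomputable section

open NumberField IsDedekindDomain
open scoped Matrix MatrixGroups

namespace Literature.NumberTheory.Rogawski1990

open Literature.NumberTheory.Automorphic Literature.LinearAlgebra.Matrix
open Literature.AlgebraicGeometry.ShimuraVarieties (unitaryGroup mem_unitaryGroup_iff)

/-! ## §1 The determinant of the `e`-block (any commutative ring with involution and form) -/

section Block

variable {R : Type*} [CommRing R] {n : Type*} [Fintype n] [DecidableEq n] (σ : R →+* R) (H : Matrix n n R)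

/-- **`blockDet e X := det (e X e + (1 − e))`** — the determinant of the `e`-BLOCK of `X`: for an idempotent `e` and `X` commuting with `e`,
`𝑅^n = e𝑅^n ⊕ (1 − e)𝑅^n` is `X`-stable and `blockDet e X` is the determinant of `X` on the summand `e𝑅^n` (in any adapted frame
`e = diag(1, …, 1, 0, …, 0)`, `X = X₁ ⊕ X₂`, it is `det X₁`).  Frame-free, so no choice of basis enters the obstruction below.
[cite: Rogawski1990, §3.8 Prop. 3.8.1 p. 37] -/
def blockDet (e X : Matrix n n R) : R :=
  (e * X * e + (1 - e)).det

/-- Unfolding of `blockDet`. [cite: Rogawski1990, §3.8 Prop. 3.8.1 p. 37] -/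
theorem blockDet_def (e X : Matrix n n R) : blockDet e X = (e * X * e + (1 - e)).det := rfl

variable {e : Matrix n n R}

/-- The truncations `e X e + (1 − e)` multiply: for `e² = e` and `X e = e X`, `(e X e + 1 − e)(e Y e + 1 − e) = e (X Y) e + 1 − e`.
[cite: Rogawski1990, §3.8 p. 37] -/
theorem trunc_mul_trunc (he : e * e = e) {X : Matrix n n R} (hX : Commute X e) (Y : Matrix n n R) :
    (e * X * e + (1 - e)) * (e * Y * e + (1 - e)) = e * (X * Y) * e + (1 - e) := by
  have h1 : e * X * e * (e * Y * e) = e * (X * Y) * e := by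
    calc e * X * e * (e * Y * e) = e * (X * e) * (e * Y) * e := by simp only [Matrix.mul_assoc]
      _ = e * (e * X) * (e * Y) * e := by rw [hX.eq]
      _ = (e * e) * X * (e * Y) * e := by simp only [Matrix.mul_assoc]
      _ = e * (X * e) * Y * e := by rw [he]; simp only [Matrix.mul_assoc]
      _ = e * (e * X) * Y * e := by rw [hX.eq]
      _ = (e * e) * (X * Y) * e := by simp only [Matrix.mul_assoc]
      _ = e * (X * Y) * e := by rw [he]
  have h2 : e * X * e * (1 - e) = 0 := by
    rw [Matrix.mul_sub, Matrix.mul_one, Matrix.mul_assoc (e * X) e e, he, sub_self]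
  have h3 : (1 - e) * (e * Y * e) = 0 := by
    rw [Matrix.sub_mul, Matrix.one_mul, ← Matrix.mul_assoc, ← Matrix.mul_assoc, he, sub_self]
  have h4 : (1 - e) * (1 - e) = (1 : Matrix n n R) - e := by
    rw [Matrix.sub_mul, Matrix.mul_sub, Matrix.mul_sub, Matrix.one_mul, Matrix.one_mul, Matrix.mul_one, he, sub_self, sub_zero]
  rw [Matrix.add_mul, Matrix.mul_add, Matrix.mul_add, h1, h2, h3, h4, add_zero, zero_add]

/-- `blockDet e 1 = 1` for an idempotent `e`. [cite: Rogawski1990, §3.8 p. 37] -/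
theorem blockDet_one (he : e * e = e) : blockDet e (1 : Matrix n n R) = 1 := by
  rw [blockDet_def, Matrix.mul_one, he, add_sub_cancel, Matrix.det_one]

/-- **Multiplicativity on the commutant**: `blockDet e (X Y) = blockDet e X · blockDet e Y` for `e² = e` and `X` commuting with `e`.
[cite: Rogawski1990, §3.8 p. 37] -/
theorem blockDet_mul (he : e * e = e) {X : Matrix n n R} (hX : Commute X e) (Y : Matrix n n R) :
    blockDet e (X * Y) = blockDet e X * blockDet e Y := by
  rw [blockDet_def, blockDet_def, blockDet_def, ← Matrix.det_mul, trunc_mul_trunc he hX]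

/-- A unit of the commutant has unit block determinant. [cite: Rogawski1990, §3.8 p. 37] -/
theorem isUnit_blockDet (he : e * e = e) {X : Matrix n n R} (hX : Commute X e) (hXu : IsUnit X.det) : IsUnit (blockDet e X) := by
  have h : blockDet e X * blockDet e X⁻¹ = 1 := by
    rw [← blockDet_mul he hX, Matrix.mul_nonsing_inv X hXu, blockDet_one he]
  exact IsUnit.of_mul_eq_one _ h

/-- The adjoint of a truncation: `(e X e + 1 − e)⋆ = e⋆ X⋆ e⋆ + 1 − e⋆`. [cite: Rogawski1990, §3.5 p. 29] -/
theorem hermStar_trunc (hH : IsUnit H.det) (e X : Matrix n n R) :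
    hermStar σ H (e * X * e + (1 - e)) = hermStar σ H e * hermStar σ H X * hermStar σ H e + (1 - hermStar σ H e) := by
  rw [hermStar_add, hermStar_mul σ H hH, hermStar_mul σ H hH, sub_eq_add_neg, hermStar_add, hermStar_one σ H hH, ← neg_one_smul R e,
    hermStar_smul, map_neg, map_one, neg_one_smul, ← sub_eq_add_neg, Matrix.mul_assoc]

/-- **`blockDet e (X⋆) = σ (blockDet e X)`** when `e⋆ = e` (`det Y⋆ = σ det Y`, ★ `det_hermStar`). [cite: Rogawski1990, §3.5 p. 29; §3.8 p. 37] -/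
theorem blockDet_hermStar (hH : IsUnit H.det) (hes : hermStar σ H e = e) (X : Matrix n n R) :
    blockDet e (hermStar σ H X) = σ (blockDet e X) := by
  rw [blockDet_def, blockDet_def, ← det_hermStar σ hH, hermStar_trunc σ H hH, hes]

/-- If `e⋆ = e` and `t` commutes with `e`, so does `t⋆`. [cite: Rogawski1990, §3.5 p. 29] -/
theorem commute_hermStar_of_commute (hH : IsUnit H.det) (hes : hermStar σ H e = e) {t : Matrix n n R} (ht : Commute t e) :
    Commute (hermStar σ H t) e := by
  have h := congrArg (hermStar σ H) ht.eq
  rw [hermStar_mul σ H hH, hermStar_mul σ H hH, hes] at h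
  exact h.symm

/-- **The norm-class law**: for `e² = e = e⋆` and `t, X` commuting with `e`,
`blockDet e (t⋆ X t) = σ(blockDet e t) · blockDet e X · blockDet e t` — changing a representative of the class `{t⋆ X t}` multiplies the block
determinant by a NORM `σ(c) c`. [cite: Rogawski1990, §3.8 Prop. 3.8.1 (d) p. 37] [cite: Kottwitz1986, §9] -/
theorem blockDet_hermStar_mul_mul (hH : IsUnit H.det) (he : e * e = e) (hes : hermStar σ H e = e) {t X : Matrix n n R}
    (ht : Commute t e) (hX : Commute X e) :
    blockDet e (hermStar σ H t * X * t) = σ (blockDet e t) * blockDet e X * blockDet e t := by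
  have hts : Commute (hermStar σ H t) e := commute_hermStar_of_commute σ H hH hes ht
  rw [blockDet_mul he (hts.mul_left hX) t, blockDet_mul he hts X, blockDet_hermStar σ H hH hes]

end Block

/-! ## §2 The block determinant of the adelic Cartan class at a SPLIT SEMISIMPLE `γ₀ ∈ U(H)(L⁺)` -/

section Singular

variable {L : Type} [Field L] [NumberField L] [IsCMField L] {H : Matrix (Fin 3) (Fin 3) L}

/-- **The adelic Lagrange idempotent `e_{a,b}(γ₀) ⊗ 1 := (a − b)⁻¹ (γ₀ − b) ⊗ 1 ∈ M₃(𝔸_L)`** of a rational `γ₀` killed by `(X − a)(X − b)`,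
`a ≠ b ∈ L`: the projector onto the `a`-eigenspace (rank `2` at a singular semisimple class of `U(3)`, eigenvalues `(a, a, b)`), read in the
adèles.  It is a polynomial in `γ₀ ⊗ 1`, hence commutes with the adelic Cartan algebra `Z(γ₀ ⊗ 1)`, and it is `⋆`-self-adjoint when
`a ā = b b̄ = 1` (★ `hermAdjoint_lagrange_idem_eq`). [cite: Rogawski1990, §3.8 p. 37] [cite: Kottwitz1986, §7 Prop. 7.1] -/
def adelicLagrangeIdem (γ₀ : (UnitaryGroup.cmDatum L 3 H).Rational) (a b : L) : Matrix (Fin 3) (Fin 3) (AdeleRing (𝓞 L) L) :=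
  ((a - b)⁻¹ • ((((γ₀ : unitaryGroup (cmConjRingHom L) H).val : GL (Fin 3) L) : Matrix (Fin 3) (Fin 3) L) - b • (1 : Matrix (Fin 3) (Fin 3) L))).map
    (algebraMap L (AdeleRing (𝓞 L) L))

variable {γ₀ : (UnitaryGroup.cmDatum L 3 H).Rational} {a b : L}

/-- Unfolding of `adelicLagrangeIdem` in adelic letters: `e ⊗ 1 = (a − b)⁻¹ • (γ₀ ⊗ 1 − b • 1)`. [cite: Rogawski1990, §3.8 p. 37] -/
theorem adelicLagrangeIdem_eq (γ₀ : (UnitaryGroup.cmDatum L 3 H).Rational) (a b : L) :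
    adelicLagrangeIdem γ₀ a b =
      algebraMap L (AdeleRing (𝓞 L) L) (a - b)⁻¹ •
        (((((UnitaryGroup.cmDatum L 3 H).toAdelic γ₀).val : GL (Fin 3) (AdeleRing (𝓞 L) L)) : Matrix (Fin 3) (Fin 3) (AdeleRing (𝓞 L) L)) -
          algebraMap L (AdeleRing (𝓞 L) L) b • (1 : Matrix (Fin 3) (Fin 3) (AdeleRing (𝓞 L) L))) := by
  have hγA : ((((UnitaryGroup.cmDatum L 3 H).toAdelic γ₀).val : GL (Fin 3) (AdeleRing (𝓞 L) L)) : Matrix (Fin 3) (Fin 3) (AdeleRing (𝓞 L) L)) =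
      ((((γ₀ : unitaryGroup (cmConjRingHom L) H).val : GL (Fin 3) L) : Matrix (Fin 3) (Fin 3) L)).map (algebraMap L (AdeleRing (𝓞 L) L)) := rfl
  rw [hγA, adelicLagrangeIdem]
  ext i j
  simp only [Matrix.map_apply, Matrix.smul_apply, Matrix.sub_apply, Matrix.one_apply, smul_eq_mul, map_mul, map_sub,
    apply_ite (algebraMap L (AdeleRing (𝓞 L) L)), map_zero, mul_ite, mul_one, mul_zero]

/-- `e ⊗ 1` is an idempotent (`(γ₀ − a)(γ₀ − b) = 0`, `a ≠ b`; ★ `isIdempotentElem_smul_sub_of_mul_sub_eq_zero` read in the adèles).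
[cite: Rogawski1990, §3.8 p. 37] -/
theorem adelicLagrangeIdem_mul_self (hab : a ≠ b)
    (hγ₀ : ((((γ₀ : unitaryGroup (cmConjRingHom L) H).val : GL (Fin 3) L) : Matrix (Fin 3) (Fin 3) L) - a • (1 : Matrix (Fin 3) (Fin 3) L)) *
      ((((γ₀ : unitaryGroup (cmConjRingHom L) H).val : GL (Fin 3) L) : Matrix (Fin 3) (Fin 3) L) - b • (1 : Matrix (Fin 3) (Fin 3) L)) = 0) :
    adelicLagrangeIdem γ₀ a b * adelicLagrangeIdem γ₀ a b = adelicLagrangeIdem γ₀ a b := by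
  have hu : (a - b)⁻¹ * (a - b) = 1 := inv_mul_cancel₀ (sub_ne_zero.2 hab)
  have h := (isIdempotentElem_smul_sub_of_mul_sub_eq_zero hu hγ₀).eq
  rw [adelicLagrangeIdem, ← Matrix.map_mul, h]

/-- `e ⊗ 1` commutes with everything that commutes with `γ₀ ⊗ 1` (it is a polynomial in `γ₀ ⊗ 1`). [cite: Rogawski1990, §3.8 p. 37] -/
theorem commute_adelicLagrangeIdem {t : Matrix (Fin 3) (Fin 3) (AdeleRing (𝓞 L) L)}
    (ht : Commute t ((((UnitaryGroup.cmDatum L 3 H).toAdelic γ₀).val : GL (Fin 3) (AdeleRing (𝓞 L) L)) : Matrix (Fin 3) (Fin 3) (AdeleRing (𝓞 L) L))) :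
    Commute t (adelicLagrangeIdem γ₀ a b) := by
  rw [adelicLagrangeIdem_eq]
  exact (ht.sub_right ((Commute.one_right t).smul_right _)).smul_right _

/-- **`(e ⊗ 1)⋆ = e ⊗ 1`** — the Lagrange idempotent of a unitary `γ₀` with UNITARY eigenvalues `a ā = b b̄ = 1` is self-adjoint for the
adelic form `H ⊗ 1` (★ `hermAdjoint_lagrange_idem_eq` over `(𝔸_L, c ⊗ 1)`): the two eigen-summands are `H`-orthogonal.
[cite: Rogawski1990, §3.8 p. 37] [cite: Kottwitz1986, §7 Prop. 7.1] -/
theorem hermStar_adelicLagrangeIdem (hHd : IsUnit H.det) (hab : a ≠ b) (ha : a * cmConjRingHom L a = 1) (hb : b * cmConjRingHom L b = 1)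
    (hγ₀ : ((((γ₀ : unitaryGroup (cmConjRingHom L) H).val : GL (Fin 3) L) : Matrix (Fin 3) (Fin 3) L) - a • (1 : Matrix (Fin 3) (Fin 3) L)) *
      ((((γ₀ : unitaryGroup (cmConjRingHom L) H).val : GL (Fin 3) L) : Matrix (Fin 3) (Fin 3) L) - b • (1 : Matrix (Fin 3) (Fin 3) L)) = 0) :
    hermStar (adeleConj L) (H.map (algebraMap L (AdeleRing (𝓞 L) L))) (adelicLagrangeIdem γ₀ a b) = adelicLagrangeIdem γ₀ a b := by
  set alg := algebraMap L (AdeleRing (𝓞 L) L) with halg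
  set γA : Matrix (Fin 3) (Fin 3) (AdeleRing (𝓞 L) L) :=
    ((((UnitaryGroup.cmDatum L 3 H).toAdelic γ₀).val : GL (Fin 3) (AdeleRing (𝓞 L) L)) : Matrix (Fin 3) (Fin 3) (AdeleRing (𝓞 L) L)) with hγA_def
  have hγA : γA = ((((γ₀ : unitaryGroup (cmConjRingHom L) H).val : GL (Fin 3) L) : Matrix (Fin 3) (Fin 3) L)).map alg := rfl
  have hone : (1 : Matrix (Fin 3) (Fin 3) L).map alg = 1 := Matrix.map_one alg (map_zero alg) (map_one alg)
  have hsmul : ∀ (c : L) (X : Matrix (Fin 3) (Fin 3) L), (c • X).map alg = alg c • X.map alg := fun c X => by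
    ext i j; simp only [Matrix.map_apply, Matrix.smul_apply, smul_eq_mul, map_mul]
  -- the hypotheses of ★ `hermAdjoint_lagrange_idem_eq` over `𝔸_L`
  have hu : alg (a - b)⁻¹ * (alg a - alg b) = 1 := by
    rw [← map_sub, ← map_mul, inv_mul_cancel₀ (sub_ne_zero.2 hab), map_one]
  have ha' : alg a * adeleConj L (alg a) = 1 := by rw [adeleConj_algebraMap, ← map_mul, ha, map_one]
  have hb' : alg b * adeleConj L (alg b) = 1 := by rw [adeleConj_algebraMap, ← map_mul, hb, map_one]
  have hγA0 : (γA - alg a • (1 : Matrix (Fin 3) (Fin 3) (AdeleRing (𝓞 L) L))) * (γA - alg b • 1) = 0 := by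
    have h := congrArg (fun X : Matrix (Fin 3) (Fin 3) L => X.map alg) hγ₀
    simpa only [Matrix.map_mul, Matrix.map_sub _ (map_sub alg), hsmul, hone, Matrix.map_zero alg (map_zero alg), ← hγA] using h
  have hγU : (γA.map (adeleConj L))ᵀ * H.map alg * γA = H.map alg := mem_unitaryGroup_iff.1 (toAdelic_val_mem_unitaryGroup γ₀)
  rw [hermStar_def, adelicLagrangeIdem_eq]
  exact hermAdjoint_lagrange_idem_eq (adeleConj L) (isUnit_det_adelicForm hHd) hu ha' hb' hγA0 hγU

/-- **`adelicBlockDet γ₀ a b g := blockDet (e ⊗ 1) x_g`**, `x_g = (H ⊗ 1)⁻¹ · ᵗ(σ𝔸 g)(H ⊗ 1) g` the adelic Cartan class of `g ∈ GL₃(𝔸_L)`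
(★ `AdelicCartanClass`) — the DETERMINANT OF THE RANK-2 BLOCK of the class of an adelic conjugator `g` of a matching adèle over the
singular semisimple `γ₀` (eigenvalues `(a, a, b)`), in any `γ₀`-adapted frame `det(x_g)_a`.  It is a `σ𝔸`-fixed adelic unit whose class
modulo global elements and norms is the obstruction (`singularObs`). [cite: Rogawski1990, §3.8 Prop. 3.8.1 (d) p. 37; §3.3 (3.3.1) p. 22]
[cite: Kottwitz1986, §9] -/
def adelicBlockDet (γ₀ : (UnitaryGroup.cmDatum L 3 H).Rational) (a b : L) (g : GL (Fin 3) (AdeleRing (𝓞 L) L)) : AdeleRing (𝓞 L) L :=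
  blockDet (adelicLagrangeIdem γ₀ a b)
    ((H.map (algebraMap L (AdeleRing (𝓞 L) L)))⁻¹ * twistGram (adeleConj L) (H.map (algebraMap L (AdeleRing (𝓞 L) L))) (g : Matrix (Fin 3) (Fin 3) (AdeleRing (𝓞 L) L)))

/-- Unfolding of `adelicBlockDet`. [cite: Rogawski1990, §3.8 Prop. 3.8.1 (d) p. 37] -/
theorem adelicBlockDet_def (γ₀ : (UnitaryGroup.cmDatum L 3 H).Rational) (a b : L) (g : GL (Fin 3) (AdeleRing (𝓞 L) L)) :
    adelicBlockDet γ₀ a b g = blockDet (adelicLagrangeIdem γ₀ a b)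
      ((H.map (algebraMap L (AdeleRing (𝓞 L) L)))⁻¹ * twistGram (adeleConj L) (H.map (algebraMap L (AdeleRing (𝓞 L) L))) (g : Matrix (Fin 3) (Fin 3) (AdeleRing (𝓞 L) L))) :=
  rfl

/-- At the trivial conjugator the block determinant is `1` (`x_1 = 1`). [cite: Rogawski1990, §3.3 (3.3.1) p. 22] -/
theorem adelicBlockDet_one (hHd : IsUnit H.det) (hab : a ≠ b)
    (hγ₀ : ((((γ₀ : unitaryGroup (cmConjRingHom L) H).val : GL (Fin 3) L) : Matrix (Fin 3) (Fin 3) L) - a • (1 : Matrix (Fin 3) (Fin 3) L)) *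
      ((((γ₀ : unitaryGroup (cmConjRingHom L) H).val : GL (Fin 3) L) : Matrix (Fin 3) (Fin 3) L) - b • (1 : Matrix (Fin 3) (Fin 3) L)) = 0) :
    adelicBlockDet γ₀ a b 1 = 1 := by
  rw [adelicBlockDet_def, Units.val_one, twistGram_def, Matrix.map_one (adeleConj L) (map_zero _) (map_one _), Matrix.transpose_one,
    Matrix.one_mul, Matrix.mul_one, Matrix.nonsing_inv_mul _ (isUnit_det_adelicForm hHd)]
  exact blockDet_one (adelicLagrangeIdem_mul_self hab hγ₀)

/-- **The block determinant is `σ𝔸`-FIXED**: `x_g⋆ = x_g` (★ `hermStar_adelicCartan`) and `(e ⊗ 1)⋆ = e ⊗ 1`, so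
`σ𝔸 (blockDet x_g) = blockDet (x_g⋆) = blockDet x_g` — the block determinant lies in `𝔸_{L⁺} = 𝔸_L^{σ}`.
[cite: Rogawski1990, §3.8 Prop. 3.8.1 (d) p. 37] [cite: Kottwitz1986, §9] -/
theorem adeleConj_adelicBlockDet (hH : (H.map (cmConjRingHom L))ᵀ = H) (hHd : IsUnit H.det) (hab : a ≠ b)
    (ha : a * cmConjRingHom L a = 1) (hb : b * cmConjRingHom L b = 1)
    (hγ₀ : ((((γ₀ : unitaryGroup (cmConjRingHom L) H).val : GL (Fin 3) L) : Matrix (Fin 3) (Fin 3) L) - a • (1 : Matrix (Fin 3) (Fin 3) L)) *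
      ((((γ₀ : unitaryGroup (cmConjRingHom L) H).val : GL (Fin 3) L) : Matrix (Fin 3) (Fin 3) L) - b • (1 : Matrix (Fin 3) (Fin 3) L)) = 0)
    (g : GL (Fin 3) (AdeleRing (𝓞 L) L)) :
    adeleConj L (adelicBlockDet γ₀ a b g) = adelicBlockDet γ₀ a b g := by
  rw [adelicBlockDet_def, ← blockDet_hermStar (adeleConj L) _ (isUnit_det_adelicForm hHd) (hermStar_adelicLagrangeIdem hHd hab ha hb hγ₀),
    hermStar_adelicCartan hH hHd]

/-- **The block determinant is an adelic UNIT** for an adelic conjugator `g` of a matching adèle `p` over `γ₀` (`x_g` is a unit of the adelic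
Cartan algebra, ★ `commute_adelicCartan`, ★ `det_adelicCartan`). [cite: Rogawski1990, §3.3 (3.3.1) p. 22] [cite: Kottwitz1986, §9] -/
theorem isUnit_adelicBlockDet (hHd : IsUnit H.det) (hab : a ≠ b)
    (hγ₀ : ((((γ₀ : unitaryGroup (cmConjRingHom L) H).val : GL (Fin 3) L) : Matrix (Fin 3) (Fin 3) L) - a • (1 : Matrix (Fin 3) (Fin 3) L)) *
      ((((γ₀ : unitaryGroup (cmConjRingHom L) H).val : GL (Fin 3) L) : Matrix (Fin 3) (Fin 3) L) - b • (1 : Matrix (Fin 3) (Fin 3) L)) = 0)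
    (p : MatchingAdeleG₂ L H H γ₀) {g : GL (Fin 3) (AdeleRing (𝓞 L) L)}
    (hg : g * (((UnitaryGroup.cmDatum L 3 H).toAdelic γ₀).val : GL (Fin 3) (AdeleRing (𝓞 L) L)) * g⁻¹ = (p.adele.val : GL (Fin 3) (AdeleRing (𝓞 L) L))) :
    IsUnit (adelicBlockDet γ₀ a b g) := by
  rw [adelicBlockDet_def]
  refine isUnit_blockDet (adelicLagrangeIdem_mul_self hab hγ₀) (commute_adelicLagrangeIdem (commute_adelicCartan hHd p hg)) ?_
  rw [det_adelicCartan hHd]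
  exact ((Matrix.isUnits_det_units g).map (adeleConj L)).mul (Matrix.isUnits_det_units g)

/-- Core of the well-definedness: if `x_{g′} = t⋆ x_g t` with `t ∈ Z(γ₀ ⊗ 1)` (and `g` an adelic conjugator of a matching adèle, so that
`x_g ∈ Z(γ₀ ⊗ 1)`), then `blockDet x_{g′} = σ𝔸(c) · blockDet x_g · c` with `c = blockDet t` an adelic unit (`blockDet_hermStar_mul_mul`).
[cite: Rogawski1990, §3.8 Prop. 3.8.1 (d) p. 37] [cite: Kottwitz1986, §9] -/
theorem exists_adelicBlockDet_eq_adeleConj_mul_mul_of_eq (hHd : IsUnit H.det) (hab : a ≠ b)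
    (ha : a * cmConjRingHom L a = 1) (hb : b * cmConjRingHom L b = 1)
    (hγ₀ : ((((γ₀ : unitaryGroup (cmConjRingHom L) H).val : GL (Fin 3) L) : Matrix (Fin 3) (Fin 3) L) - a • (1 : Matrix (Fin 3) (Fin 3) L)) *
      ((((γ₀ : unitaryGroup (cmConjRingHom L) H).val : GL (Fin 3) L) : Matrix (Fin 3) (Fin 3) L) - b • (1 : Matrix (Fin 3) (Fin 3) L)) = 0)
    (p : MatchingAdeleG₂ L H H γ₀) {g g' t : GL (Fin 3) (AdeleRing (𝓞 L) L)}
    (hg : g * (((UnitaryGroup.cmDatum L 3 H).toAdelic γ₀).val : GL (Fin 3) (AdeleRing (𝓞 L) L)) * g⁻¹ = (p.adele.val : GL (Fin 3) (AdeleRing (𝓞 L) L)))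
    (ht : t * (((UnitaryGroup.cmDatum L 3 H).toAdelic γ₀).val : GL (Fin 3) (AdeleRing (𝓞 L) L)) =
      (((UnitaryGroup.cmDatum L 3 H).toAdelic γ₀).val : GL (Fin 3) (AdeleRing (𝓞 L) L)) * t)
    (hx : (H.map (algebraMap L (AdeleRing (𝓞 L) L)))⁻¹ * twistGram (adeleConj L) (H.map (algebraMap L (AdeleRing (𝓞 L) L))) (g' : Matrix (Fin 3) (Fin 3) (AdeleRing (𝓞 L) L)) =
      hermStar (adeleConj L) (H.map (algebraMap L (AdeleRing (𝓞 L) L))) (t : Matrix (Fin 3) (Fin 3) (AdeleRing (𝓞 L) L)) *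
        ((H.map (algebraMap L (AdeleRing (𝓞 L) L)))⁻¹ * twistGram (adeleConj L) (H.map (algebraMap L (AdeleRing (𝓞 L) L))) (g : Matrix (Fin 3) (Fin 3) (AdeleRing (𝓞 L) L))) *
        (t : Matrix (Fin 3) (Fin 3) (AdeleRing (𝓞 L) L))) :
    ∃ c : AdeleRing (𝓞 L) L, IsUnit c ∧ adelicBlockDet γ₀ a b g' = adeleConj L c * adelicBlockDet γ₀ a b g * c := by
  have he := adelicLagrangeIdem_mul_self hab hγ₀
  have hes := hermStar_adelicLagrangeIdem hHd hab ha hb hγ₀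
  have htM : Commute ((t : Matrix (Fin 3) (Fin 3) (AdeleRing (𝓞 L) L)))
      ((((UnitaryGroup.cmDatum L 3 H).toAdelic γ₀).val : GL (Fin 3) (AdeleRing (𝓞 L) L)) : Matrix (Fin 3) (Fin 3) (AdeleRing (𝓞 L) L)) := by
    have h := congrArg (fun u : GL (Fin 3) (AdeleRing (𝓞 L) L) => (u : Matrix (Fin 3) (Fin 3) (AdeleRing (𝓞 L) L))) ht
    simp only [Units.val_mul] at h
    exact h
  have hte : Commute ((t : Matrix (Fin 3) (Fin 3) (AdeleRing (𝓞 L) L))) (adelicLagrangeIdem γ₀ a b) := commute_adelicLagrangeIdem htM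
  have hxe := commute_adelicLagrangeIdem (a := a) (b := b) (commute_adelicCartan hHd p hg)
  refine ⟨blockDet (adelicLagrangeIdem γ₀ a b) (t : Matrix (Fin 3) (Fin 3) (AdeleRing (𝓞 L) L)),
    isUnit_blockDet he hte (Matrix.isUnits_det_units t), ?_⟩
  rw [adelicBlockDet_def, adelicBlockDet_def, hx]
  exact blockDet_hermStar_mul_mul (adeleConj L) _ (isUnit_det_adelicForm hHd) he hes hte hxe

/-- **TWO ADELIC CONJUGATORS give NORM-EQUIVALENT block determinants**: if `g (γ₀ ⊗ 1) g⁻¹ = p = g′ (γ₀ ⊗ 1) g′⁻¹` then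
`blockDet x_{g′} = σ𝔸(c) · blockDet x_g · c` for an adelic unit `c` (`x_{g′} = t⋆ x_g t` with `t ∈ Z(γ₀ ⊗ 1)`, ★
`exists_commute_adelicCartan_eq_of_conj_eq`) — the class of the block determinant in `𝔸_{L⁺}ˣ ∕ N(𝔸_Lˣ)` depends on `p` only.
[cite: Rogawski1990, §3.3 (3.3.1) p. 22; §3.8 Prop. 3.8.1 (d) p. 37] [cite: Kottwitz1986, §9] -/
theorem exists_adelicBlockDet_eq_adeleConj_mul_mul (hHd : IsUnit H.det) (hab : a ≠ b)
    (ha : a * cmConjRingHom L a = 1) (hb : b * cmConjRingHom L b = 1)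
    (hγ₀ : ((((γ₀ : unitaryGroup (cmConjRingHom L) H).val : GL (Fin 3) L) : Matrix (Fin 3) (Fin 3) L) - a • (1 : Matrix (Fin 3) (Fin 3) L)) *
      ((((γ₀ : unitaryGroup (cmConjRingHom L) H).val : GL (Fin 3) L) : Matrix (Fin 3) (Fin 3) L) - b • (1 : Matrix (Fin 3) (Fin 3) L)) = 0)
    (p : MatchingAdeleG₂ L H H γ₀) {g g' : GL (Fin 3) (AdeleRing (𝓞 L) L)}
    (hg : g * (((UnitaryGroup.cmDatum L 3 H).toAdelic γ₀).val : GL (Fin 3) (AdeleRing (𝓞 L) L)) * g⁻¹ = (p.adele.val : GL (Fin 3) (AdeleRing (𝓞 L) L)))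
    (hg' : g' * (((UnitaryGroup.cmDatum L 3 H).toAdelic γ₀).val : GL (Fin 3) (AdeleRing (𝓞 L) L)) * g'⁻¹ = (p.adele.val : GL (Fin 3) (AdeleRing (𝓞 L) L))) :
    ∃ c : AdeleRing (𝓞 L) L, IsUnit c ∧ adelicBlockDet γ₀ a b g' = adeleConj L c * adelicBlockDet γ₀ a b g * c := by
  obtain ⟨t, ht, hx⟩ := exists_commute_adelicCartan_eq_of_conj_eq hHd p hg hg'
  exact exists_adelicBlockDet_eq_adeleConj_mul_mul_of_eq hHd hab ha hb hγ₀ p hg ht hx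

/-- **The block determinant class is a CLASS FUNCTION on `𝒞′_𝐀(γ₀)`**: for `U(H)(𝐀)`-conjugate matching adèles `p ∼ q` with adelic conjugators
`g` of `p` and `g′` of `q`, again `blockDet x_{g′} = σ𝔸(c) · blockDet x_g · c` (★ `exists_commute_adelicCartan_eq_of_isConjAdele`).
[cite: Rogawski1990, §3.3 (3.3.1) p. 22; §5.4 p. 72] -/
theorem exists_adelicBlockDet_eq_adeleConj_mul_mul_of_isConjAdele (hHd : IsUnit H.det) (hab : a ≠ b)
    (ha : a * cmConjRingHom L a = 1) (hb : b * cmConjRingHom L b = 1)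
    (hγ₀ : ((((γ₀ : unitaryGroup (cmConjRingHom L) H).val : GL (Fin 3) L) : Matrix (Fin 3) (Fin 3) L) - a • (1 : Matrix (Fin 3) (Fin 3) L)) *
      ((((γ₀ : unitaryGroup (cmConjRingHom L) H).val : GL (Fin 3) L) : Matrix (Fin 3) (Fin 3) L) - b • (1 : Matrix (Fin 3) (Fin 3) L)) = 0)
    {p q : MatchingAdeleG₂ L H H γ₀} (hpq : p.IsConjAdele q) {g g' : GL (Fin 3) (AdeleRing (𝓞 L) L)}
    (hg : g * (((UnitaryGroup.cmDatum L 3 H).toAdelic γ₀).val : GL (Fin 3) (AdeleRing (𝓞 L) L)) * g⁻¹ = (p.adele.val : GL (Fin 3) (AdeleRing (𝓞 L) L)))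
    (hg' : g' * (((UnitaryGroup.cmDatum L 3 H).toAdelic γ₀).val : GL (Fin 3) (AdeleRing (𝓞 L) L)) * g'⁻¹ = (q.adele.val : GL (Fin 3) (AdeleRing (𝓞 L) L))) :
    ∃ c : AdeleRing (𝓞 L) L, IsUnit c ∧ adelicBlockDet γ₀ a b g' = adeleConj L c * adelicBlockDet γ₀ a b g * c := by
  obtain ⟨t, ht, hx⟩ := exists_commute_adelicCartan_eq_of_isConjAdele hHd hpq hg hg'
  exact exists_adelicBlockDet_eq_adeleConj_mul_mul_of_eq hHd hab ha hb hγ₀ p hg ht hx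

end Singular

/-! ## §3 The singular obstruction `obs_s : 𝒞′_𝐀(γ₀) → ℤ∕2` -/

section Obstruction

variable (L : Type) [Field L] [NumberField L] [IsCMField L]

/-- **«GLOBAL × NORM» in the adèles of `L`**: `δ ∈ 𝔸_L` is a nonzero `c`-FIXED GLOBAL element of `L` times an adelic NORM `σ𝔸(z) z` of an adelic
unit `z` — the `𝔸_L`-side text of «the idèle of `L⁺` under `δ` lies in `(L⁺)ˣ · N_{L/L⁺}(𝕀_L)`», i.e. of the VANISHING of the quadratic Artin
symbol of `L/L⁺` (★ `quadraticArtinIndicator_eq_zero_iff_exists_ideleRelNorm` with ★ `coe_ideleBaseChange_principal_mul_ideleRelNorm`: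
`con((k) · N Z) = (k ⊗ 1) · (Z · c • Z)`).  Stated in `𝔸_L` so that the definition below mentions no descended idèle.
[cite: Rogawski1990, §3.8 Prop. 3.8.1 (d) p. 37] [cite: CasselsFrohlichANT1967, Ch. VII §7.3 (a)] -/
def IsPrincipalAdelicNorm (δ : AdeleRing (𝓞 L) L) : Prop :=
  ∃ (k : L) (z : (AdeleRing (𝓞 L) L)ˣ), k ≠ 0 ∧ cmConjRingHom L k = k ∧
    δ = algebraMap L (AdeleRing (𝓞 L) L) k * (adeleConj L (z : AdeleRing (𝓞 L) L) * (z : AdeleRing (𝓞 L) L))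

variable {L}

/-- Unfolding of `IsPrincipalAdelicNorm`. [cite: Rogawski1990, §3.8 Prop. 3.8.1 (d) p. 37] -/
theorem isPrincipalAdelicNorm_iff (δ : AdeleRing (𝓞 L) L) :
    IsPrincipalAdelicNorm L δ ↔ ∃ (k : L) (z : (AdeleRing (𝓞 L) L)ˣ), k ≠ 0 ∧ cmConjRingHom L k = k ∧
      δ = algebraMap L (AdeleRing (𝓞 L) L) k * (adeleConj L (z : AdeleRing (𝓞 L) L) * (z : AdeleRing (𝓞 L) L)) :=
  Iff.rfl

/-- `1` is «global × norm». [cite: Rogawski1990, §3.8 p. 37] -/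
theorem isPrincipalAdelicNorm_one : IsPrincipalAdelicNorm L 1 :=
  ⟨1, 1, one_ne_zero, map_one _, by rw [map_one, Units.val_one, map_one, one_mul, one_mul]⟩

/-- «Global × norm» is stable under multiplication by a NORM `σ𝔸(c) · c` of an adelic unit. [cite: Rogawski1990, §3.8 Prop. 3.8.1 (d) p. 37] -/
theorem IsPrincipalAdelicNorm.adeleConj_mul_mul {δ : AdeleRing (𝓞 L) L} (h : IsPrincipalAdelicNorm L δ) {c : AdeleRing (𝓞 L) L}
    (hc : IsUnit c) : IsPrincipalAdelicNorm L (adeleConj L c * δ * c) := by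
  obtain ⟨k, z, hk, hkc, rfl⟩ := h
  refine ⟨k, z * hc.unit, hk, hkc, ?_⟩
  rw [Units.val_mul, IsUnit.unit_spec, map_mul]
  ring

/-- … in both directions. [cite: Rogawski1990, §3.8 Prop. 3.8.1 (d) p. 37] -/
theorem isPrincipalAdelicNorm_adeleConj_mul_mul_iff {δ c : AdeleRing (𝓞 L) L} (hc : IsUnit c) :
    IsPrincipalAdelicNorm L (adeleConj L c * δ * c) ↔ IsPrincipalAdelicNorm L δ := by
  refine ⟨fun h => ?_, fun h => h.adeleConj_mul_mul hc⟩
  have h' := h.adeleConj_mul_mul (hc.unit⁻¹).isUnit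
  have h1 : ((hc.unit⁻¹ : (AdeleRing (𝓞 L) L)ˣ) : AdeleRing (𝓞 L) L) * c = 1 := hc.unit.inv_mul
  have h2 : c * ((hc.unit⁻¹ : (AdeleRing (𝓞 L) L)ˣ) : AdeleRing (𝓞 L) L) = 1 := hc.unit.mul_inv
  have hδ : adeleConj L ((hc.unit⁻¹ : (AdeleRing (𝓞 L) L)ˣ) : AdeleRing (𝓞 L) L) * (adeleConj L c * δ * c) *
      ((hc.unit⁻¹ : (AdeleRing (𝓞 L) L)ˣ) : AdeleRing (𝓞 L) L) = δ := by
    calc adeleConj L ((hc.unit⁻¹ : (AdeleRing (𝓞 L) L)ˣ) : AdeleRing (𝓞 L) L) * (adeleConj L c * δ * c) *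
          ((hc.unit⁻¹ : (AdeleRing (𝓞 L) L)ˣ) : AdeleRing (𝓞 L) L)
          = adeleConj L (((hc.unit⁻¹ : (AdeleRing (𝓞 L) L)ˣ) : AdeleRing (𝓞 L) L) * c) * δ *
              (c * ((hc.unit⁻¹ : (AdeleRing (𝓞 L) L)ˣ) : AdeleRing (𝓞 L) L)) := by rw [map_mul]; ring
      _ = δ := by rw [h1, h2, map_one, one_mul, mul_one]
  rwa [hδ] at h'

variable {H : Matrix (Fin 3) (Fin 3) L} {γ₀ : (UnitaryGroup.cmDatum L 3 H).Rational} {a b : L}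

open scoped Classical in
/-- **THE SINGULAR OBSTRUCTION `obs_s(p) ∈ ℤ∕2`** of an adelic element `p` of the stable class of a SPLIT SEMISIMPLE `γ₀ ∈ U(H)(L⁺)`
(`(γ₀ − a)(γ₀ − b) = 0`, `a ≠ b`; for `U(3)`: eigenvalues `(a, a, b)`, centraliser `G′_{γ₀} ≅ U(H_a) × U(H_b)`, `|A(G′_{γ₀})| = 2`):
`0` iff the BLOCK DETERMINANT `blockDet x_g` of the adelic Cartan class of an adelic conjugator `g` of `p` (here the CHOSEN one, ★
`exists_gl_conj_eq_adele_of_mul_sub_eq_zero`; any other gives the same value, `singularObs_eq_zero_iff`) is «global × norm», `1` otherwise —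
the quadratic norm-residue character of `L/L⁺` on the determinant of the `GL₂`-block, i.e. Kottwitz's `obs(γ′) ∈ 𝔈(G_{γ₀}∕F) ≅ ℤ∕2`.
[cite: Rogawski1990, §3.8 Prop. 3.8.1 (a) (d) p. 37; §3.3 (3.3.1) p. 22] [cite: Kottwitz1986, §9] -/
def MatchingAdeleG₂.singularObs (hab : a ≠ b)
    (hγ₀ : ((((γ₀ : unitaryGroup (cmConjRingHom L) H).val : GL (Fin 3) L) : Matrix (Fin 3) (Fin 3) L) - a • (1 : Matrix (Fin 3) (Fin 3) L)) *
      ((((γ₀ : unitaryGroup (cmConjRingHom L) H).val : GL (Fin 3) L) : Matrix (Fin 3) (Fin 3) L) - b • (1 : Matrix (Fin 3) (Fin 3) L)) = 0)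
    (p : MatchingAdeleG₂ L H H γ₀) : ZMod 2 :=
  if IsPrincipalAdelicNorm L (adelicBlockDet γ₀ a b (MatchingAdeleG₂.exists_gl_conj_eq_adele_of_mul_sub_eq_zero hab hγ₀ p).choose) then 0 else 1

/-- Unfolding of `singularObs` at the CHOSEN conjugator. [cite: Rogawski1990, §3.8 Prop. 3.8.1 (d) p. 37] -/
theorem MatchingAdeleG₂.singularObs_eq_zero_iff_choose (hab : a ≠ b)
    (hγ₀ : ((((γ₀ : unitaryGroup (cmConjRingHom L) H).val : GL (Fin 3) L) : Matrix (Fin 3) (Fin 3) L) - a • (1 : Matrix (Fin 3) (Fin 3) L)) *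
      ((((γ₀ : unitaryGroup (cmConjRingHom L) H).val : GL (Fin 3) L) : Matrix (Fin 3) (Fin 3) L) - b • (1 : Matrix (Fin 3) (Fin 3) L)) = 0)
    (p : MatchingAdeleG₂ L H H γ₀) :
    p.singularObs hab hγ₀ = 0 ↔
      IsPrincipalAdelicNorm L (adelicBlockDet γ₀ a b (MatchingAdeleG₂.exists_gl_conj_eq_adele_of_mul_sub_eq_zero hab hγ₀ p).choose) := by
  rw [MatchingAdeleG₂.singularObs]
  split_ifs with h
  · exact ⟨fun _ => h, fun _ => rfl⟩
  · exact ⟨fun h0 => absurd h0 one_ne_zero, fun h' => absurd h' h⟩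

/-- `obs_s` takes the values `0`, `1` only. [cite: Rogawski1990, §3.8 Prop. 3.8.1 (a) p. 37] -/
theorem MatchingAdeleG₂.singularObs_eq_zero_or_eq_one (hab : a ≠ b)
    (hγ₀ : ((((γ₀ : unitaryGroup (cmConjRingHom L) H).val : GL (Fin 3) L) : Matrix (Fin 3) (Fin 3) L) - a • (1 : Matrix (Fin 3) (Fin 3) L)) *
      ((((γ₀ : unitaryGroup (cmConjRingHom L) H).val : GL (Fin 3) L) : Matrix (Fin 3) (Fin 3) L) - b • (1 : Matrix (Fin 3) (Fin 3) L)) = 0)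
    (p : MatchingAdeleG₂ L H H γ₀) : p.singularObs hab hγ₀ = 0 ∨ p.singularObs hab hγ₀ = 1 := by
  rw [MatchingAdeleG₂.singularObs]
  split_ifs
  · exact Or.inl rfl
  · exact Or.inr rfl

/-- **WELL-DEFINEDNESS — `obs_s(p) = 0` iff `blockDet x_g` is «global × norm» for ANY adelic conjugator `g` of `p`** (two conjugators change
the block determinant by a norm `σ𝔸(c) c`, `exists_adelicBlockDet_eq_adeleConj_mul_mul`).  This is the clause `hglob_s` of the singular
ObsHasse socket reads. [cite: Rogawski1990, §3.8 Prop. 3.8.1 (d) p. 37; §3.3 (3.3.1) p. 22] [cite: Kottwitz1986, §9] -/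
theorem MatchingAdeleG₂.singularObs_eq_zero_iff (hHd : IsUnit H.det) (hab : a ≠ b) (ha : a * cmConjRingHom L a = 1) (hb : b * cmConjRingHom L b = 1)
    (hγ₀ : ((((γ₀ : unitaryGroup (cmConjRingHom L) H).val : GL (Fin 3) L) : Matrix (Fin 3) (Fin 3) L) - a • (1 : Matrix (Fin 3) (Fin 3) L)) *
      ((((γ₀ : unitaryGroup (cmConjRingHom L) H).val : GL (Fin 3) L) : Matrix (Fin 3) (Fin 3) L) - b • (1 : Matrix (Fin 3) (Fin 3) L)) = 0)
    (p : MatchingAdeleG₂ L H H γ₀) {g : GL (Fin 3) (AdeleRing (𝓞 L) L)}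
    (hg : g * (((UnitaryGroup.cmDatum L 3 H).toAdelic γ₀).val : GL (Fin 3) (AdeleRing (𝓞 L) L)) * g⁻¹ = (p.adele.val : GL (Fin 3) (AdeleRing (𝓞 L) L))) :
    p.singularObs hab hγ₀ = 0 ↔ IsPrincipalAdelicNorm L (adelicBlockDet γ₀ a b g) := by
  obtain ⟨c, hc, hcg⟩ := exists_adelicBlockDet_eq_adeleConj_mul_mul hHd hab ha hb hγ₀ p hg
    (MatchingAdeleG₂.exists_gl_conj_eq_adele_of_mul_sub_eq_zero hab hγ₀ p).choose_spec
  rw [p.singularObs_eq_zero_iff_choose hab hγ₀, hcg, isPrincipalAdelicNorm_adeleConj_mul_mul_iff hc]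

/-- `obs_s(p) = 1` iff the block determinant of (any) adelic conjugator is NOT «global × norm». [cite: Rogawski1990, §3.8 Prop. 3.8.1 (d) p. 37] -/
theorem MatchingAdeleG₂.singularObs_eq_one_iff (hHd : IsUnit H.det) (hab : a ≠ b) (ha : a * cmConjRingHom L a = 1) (hb : b * cmConjRingHom L b = 1)
    (hγ₀ : ((((γ₀ : unitaryGroup (cmConjRingHom L) H).val : GL (Fin 3) L) : Matrix (Fin 3) (Fin 3) L) - a • (1 : Matrix (Fin 3) (Fin 3) L)) *
      ((((γ₀ : unitaryGroup (cmConjRingHom L) H).val : GL (Fin 3) L) : Matrix (Fin 3) (Fin 3) L) - b • (1 : Matrix (Fin 3) (Fin 3) L)) = 0)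
    (p : MatchingAdeleG₂ L H H γ₀) {g : GL (Fin 3) (AdeleRing (𝓞 L) L)}
    (hg : g * (((UnitaryGroup.cmDatum L 3 H).toAdelic γ₀).val : GL (Fin 3) (AdeleRing (𝓞 L) L)) * g⁻¹ = (p.adele.val : GL (Fin 3) (AdeleRing (𝓞 L) L))) :
    p.singularObs hab hγ₀ = 1 ↔ ¬ IsPrincipalAdelicNorm L (adelicBlockDet γ₀ a b g) := by
  rw [← p.singularObs_eq_zero_iff hHd hab ha hb hγ₀ hg]
  rcases p.singularObs_eq_zero_or_eq_one hab hγ₀ with h | h <;> simp [h]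

/-- **`obs_s` is constant on `U(H)(𝐀)`-conjugacy classes** (`exists_adelicBlockDet_eq_adeleConj_mul_mul_of_isConjAdele`): a function on
`𝒞′_𝐀(γ₀) = MatchingAdeleG₂.classes`. [cite: Rogawski1990, §3.3 (3.3.1) p. 22; §5.4 p. 72] -/
theorem MatchingAdeleG₂.singularObs_eq_of_isConjAdele (hHd : IsUnit H.det) (hab : a ≠ b) (ha : a * cmConjRingHom L a = 1)
    (hb : b * cmConjRingHom L b = 1)
    (hγ₀ : ((((γ₀ : unitaryGroup (cmConjRingHom L) H).val : GL (Fin 3) L) : Matrix (Fin 3) (Fin 3) L) - a • (1 : Matrix (Fin 3) (Fin 3) L)) *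
      ((((γ₀ : unitaryGroup (cmConjRingHom L) H).val : GL (Fin 3) L) : Matrix (Fin 3) (Fin 3) L) - b • (1 : Matrix (Fin 3) (Fin 3) L)) = 0)
    {p q : MatchingAdeleG₂ L H H γ₀} (hpq : p.IsConjAdele q) : p.singularObs hab hγ₀ = q.singularObs hab hγ₀ := by
  obtain ⟨c, hc, hcg⟩ := exists_adelicBlockDet_eq_adeleConj_mul_mul_of_isConjAdele hHd hab ha hb hγ₀ hpq
    (MatchingAdeleG₂.exists_gl_conj_eq_adele_of_mul_sub_eq_zero hab hγ₀ p).choose_spec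
    (MatchingAdeleG₂.exists_gl_conj_eq_adele_of_mul_sub_eq_zero hab hγ₀ q).choose_spec
  have hiff : p.singularObs hab hγ₀ = 0 ↔ q.singularObs hab hγ₀ = 0 := by
    rw [p.singularObs_eq_zero_iff_choose hab hγ₀, q.singularObs_eq_zero_iff_choose hab hγ₀, hcg,
      isPrincipalAdelicNorm_adeleConj_mul_mul_iff hc]
  rcases p.singularObs_eq_zero_or_eq_one hab hγ₀ with hp | hp <;>
    rcases q.singularObs_eq_zero_or_eq_one hab hγ₀ with hq | hq
  · rw [hp, hq]
  · exact absurd (hiff.1 hp) (by rw [hq]; exact one_ne_zero)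
  · exact absurd (hiff.2 hq) (by rw [hp]; exact one_ne_zero)
  · rw [hp, hq]

/-- **The base point has trivial obstruction**: `obs_s(γ₀ ⊗ 1) = 0` (conjugator `g = 1`, `x_1 = 1`, block determinant `1`).
[cite: Rogawski1990, §3.3 (3.3.1) p. 22] -/
theorem MatchingAdeleG₂.singularObs_self (hHd : IsUnit H.det) (hab : a ≠ b) (ha : a * cmConjRingHom L a = 1) (hb : b * cmConjRingHom L b = 1)
    (hγ₀ : ((((γ₀ : unitaryGroup (cmConjRingHom L) H).val : GL (Fin 3) L) : Matrix (Fin 3) (Fin 3) L) - a • (1 : Matrix (Fin 3) (Fin 3) L)) *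
      ((((γ₀ : unitaryGroup (cmConjRingHom L) H).val : GL (Fin 3) L) : Matrix (Fin 3) (Fin 3) L) - b • (1 : Matrix (Fin 3) (Fin 3) L)) = 0) :
    (MatchingAdeleG₂.self γ₀).singularObs hab hγ₀ = 0 := by
  have hg : (1 : GL (Fin 3) (AdeleRing (𝓞 L) L)) * (((UnitaryGroup.cmDatum L 3 H).toAdelic γ₀).val : GL (Fin 3) (AdeleRing (𝓞 L) L)) * 1⁻¹ =
      ((MatchingAdeleG₂.self γ₀).adele.val : GL (Fin 3) (AdeleRing (𝓞 L) L)) := by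
    rw [one_mul, inv_one, mul_one, MatchingAdeleG₂.adele_self]
  rw [(MatchingAdeleG₂.self γ₀).singularObs_eq_zero_iff hHd hab ha hb hγ₀ hg, adelicBlockDet_one hHd hab hγ₀]
  exact isPrincipalAdelicNorm_one

end Obstruction

end Literature.NumberTheory.Rogawski1990

end
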